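import Summits.CriticalPhenomena.PercolationContinuityZ3.Theorems.PercNearOneGluingNoHeavyLowerTailSahiThreeCopyTwoPointRefutation
import Summits.CriticalPhenomena.PercolationContinuityZ3.Theorems.PercNearOneGluingNoHeavyLowerTailSahiThreeCopyLawBackSplit

/-!
# `NoHeavyLowerTail` (crux stmt-CriticalPhenomena-4575), Sahi programme: **SOUNDNESS OF CELL CERTIFICATES** (piecewise TP₀) — the generic
# lemmas turning a finite "cell certificate" (memo FROM-prim-sahi-p1-gen64 §7–§9: a diagonal `ρ`, transfers `λ` along covers, slack `σ`, and a
# nonnegative combination of products `u ⊗ v` of admissible generators) into the hypotheses (N1), (N2)-on-the-cell of `pointwiseTP_of_cells`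

Support file (Sahi cell, seat `prim-sahi-p1`, generation 64; `--supports stmt-CriticalPhenomena-4575`); companions `…SahiThreeCopyTwoPoint` (gen 59:
`N1form`, `N2form`, `arrInd`), `…SahiThreeCopyTwoPointRefutation` (gen 60: `thetaLin`, `N1form_split`, `N2form_split`), `…SahiThreeCopyLawBackSplit`
(gen 64: `pointwiseTP_of_cells`).  Pure bookkeeping (finite sums); no `sorry`, standard axioms; nothing conjectural is used or asserted.

CONTENT.  For a front profile `π`, a slot `f` and a diagonal `ρ` on the levels put `θ_ρ(e₁,e₂,e₃) := ρ(e₁)/n₁(e₁)`, `n₁(e) = #{arrangements with e₁ = e}`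
(`thetaOf`, `nArr1`; `thetaLin_thetaOf`: `T_{θ_ρ}(w) = Σ_e ρ(e)w(e)` when every level is a first copy of some arrangement, e.g. for `π ∈ {1,2}^k`).
The `θ`-free parts of (N1), (N2) are the linear/bilinear forms with coefficients `cK(e) = Σ_arr[2f(e₁)[e₁=e] − f(e₁)[e₂=e]]` (`cKcoef`, `N1form_zero_eq`) and
`B(e,e′) = Σ_arr[f(e₁)[e₂=e][e₃=e′] − f(e₂)[e₁=e][e₂=e′] − f(e₂)[e₂=e][e₁=e′]]` (`Bcoef`, `N2form_zero_eq`).  ★ `N1form_nonneg_of_Kcert`: an identity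
`cK − ρ = Σ_i λ_i (e_{q_i} − e_{p_i}) + σ` with `λ_i ≥ 0`, `p_i ≤ q_i`, `σ ≥ 0` gives (N1) for every nonnegative monotone `κ` (against `1`).
★ `N2form_nonneg_of_GHcert`: an identity `diag(ρ) + B = Σ_i x_i · u_i ⊗ v_i` with `x_i ≥ 0` gives (N2) at every pair `(φ,ψ)` on which all `u_i·φ ≥ 0` and
`v_i·ψ ≥ 0` — the CELL condition (Hall generators are nonnegative on all monotone nonnegative functions; score differences on their cell).  These are the
two finite identities that the exact certificates of memo §9 (C₈ at 1⁸, cells (1,1) and (1,2); F₇ at 1⁷) satisfy; the kernel instantiation (data files +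
`pointwiseTP_of_cells`) is the successor's item. [this work]
-/

namespace Summit.CriticalPhenomena.PercolationContinuityZ3.Theorems.SahiThreeCopy

open Finset Function Literature.Combinatorics.Sahi2008
open scoped BigOperators

noncomputable section

variable {k : ℕ}

/-! ### §1 The diagonal weight `θ_ρ` and its `θ`-linear part -/

/-- `n₁(e)` = number of arrangements of `π` whose first copy is `e` (as a real). [this work] -/
def nArr1 (π : Fin k → ℕ) (e : Pt k) : ℝ := ∑ σ : Pt k × Pt k × Pt k, arrInd π σ.1 σ.2.1 σ.2.2 * (if σ.1 = e then 1 else 0)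

/-- `n₁(e) ≥ 0`. [this work] -/
theorem nArr1_nonneg (π : Fin k → ℕ) (e : Pt k) : 0 ≤ nArr1 π e :=
  sum_nonneg fun σ _ => mul_nonneg (arrInd_nonneg π _ _ _) (by split_ifs <;> norm_num)

/-- The per-arrangement weight attached to a diagonal `ρ`: `θ_ρ(e₁,e₂,e₃) = ρ(e₁)/n₁(e₁)`. [this work] -/
def thetaOf (π : Fin k → ℕ) (ρ : Pt k → ℝ) : Pt k → Pt k → Pt k → ℝ := fun e₁ _ _ => ρ e₁ / nArr1 π e₁

/-- `θ_ρ ≥ 0` for `ρ ≥ 0`. [this work] -/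
theorem thetaOf_nonneg (π : Fin k → ℕ) {ρ : Pt k → ℝ} (hρ : ∀ e, 0 ≤ ρ e) (e₁ e₂ e₃ : Pt k) : 0 ≤ thetaOf π ρ e₁ e₂ e₃ :=
  div_nonneg (hρ _) (nArr1_nonneg π _)

/-- Pulling a function of the first copy out of an arrangement sum: `Σ_arr [arr]·g(e₁) = Σ_e n₁(e)·g(e)`. [this work] -/
theorem sum_arrInd_first (π : Fin k → ℕ) (g : Pt k → ℝ) :
    ∑ σ : Pt k × Pt k × Pt k, arrInd π σ.1 σ.2.1 σ.2.2 * g σ.1 = ∑ e : Pt k, nArr1 π e * g e := by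
  have h : ∀ σ : Pt k × Pt k × Pt k, arrInd π σ.1 σ.2.1 σ.2.2 * g σ.1 =
      ∑ e : Pt k, arrInd π σ.1 σ.2.1 σ.2.2 * (if σ.1 = e then 1 else 0) * g e := by
    intro σ
    rw [Finset.sum_eq_single σ.1]
    · simp
    · intro e _ he; simp [Ne.symm he]
    · intro h; exact absurd (mem_univ _) h
  simp only [h]
  rw [sum_comm]
  refine sum_congr rfl fun e _ => ?_
  rw [nArr1, sum_mul]

/-- `T_{θ_ρ}(w) = Σ_e ρ(e)·w(e)` provided every level with `ρ(e) ≠ 0` is the first copy of some arrangement (`n₁(e) ≠ 0`). [this work] -/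
theorem thetaLin_thetaOf (π : Fin k → ℕ) (ρ w : Pt k → ℝ) (hn : ∀ e, nArr1 π e ≠ 0 ∨ ρ e = 0) :
    thetaLin π (thetaOf π ρ) w = ∑ e : Pt k, ρ e * w e := by
  unfold thetaLin thetaOf
  have := sum_arrInd_first π (fun e => ρ e / nArr1 π e * w e)
  rw [show (∑ σ : Pt k × Pt k × Pt k, arrInd π σ.1 σ.2.1 σ.2.2 * (ρ σ.1 / nArr1 π σ.1 * w σ.1)) =
      ∑ e : Pt k, nArr1 π e * (ρ e / nArr1 π e * w e) from this]
  refine sum_congr rfl fun e _ => ?_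
  rcases hn e with h | h
  · field_simp
  · simp [h]

/-! ### §2 The `θ`-free parts as explicit linear / bilinear forms -/

/-- Coefficient of `κ(e)` in the `θ`-free (N1) against `1`: `cK(e) = Σ_arr [2f(e₁)[e₁ = e] − f(e₁)[e₂ = e]]`. [this work] -/
def cKcoef (π : Fin k → ℕ) (f : Pt k → ℝ) (e : Pt k) : ℝ :=
  ∑ σ : Pt k × Pt k × Pt k, arrInd π σ.1 σ.2.1 σ.2.2 *
    (2 * f σ.1 * (if σ.1 = e then 1 else 0) - f σ.1 * (if σ.2.1 = e then 1 else 0))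

/-- Coefficient of `φ(e)ψ(e′)` in the `θ`-free (N2): `B(e,e′) = Σ_arr [f(e₁)[e₂=e][e₃=e′] − f(e₂)[e₁=e][e₂=e′] − f(e₂)[e₂=e][e₁=e′]]`. [this work] -/
def Bcoef (π : Fin k → ℕ) (f : Pt k → ℝ) (e e' : Pt k) : ℝ :=
  ∑ σ : Pt k × Pt k × Pt k, arrInd π σ.1 σ.2.1 σ.2.2 *
    (f σ.1 * (if σ.2.1 = e ∧ σ.2.2 = e' then 1 else 0) - f σ.2.1 * (if σ.1 = e ∧ σ.2.1 = e' then 1 else 0)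
      - f σ.2.1 * (if σ.2.1 = e ∧ σ.1 = e' then 1 else 0))

/-- Indicator sums pick out a value (plumbing). [this work] -/
theorem sum_ite_mul_eq (κ : Pt k → ℝ) (a : Pt k) : ∑ e : Pt k, (if a = e then (1 : ℝ) else 0) * κ e = κ a := by
  have : ∀ e : Pt k, (if a = e then (1 : ℝ) else 0) * κ e = if a = e then κ e else 0 := fun e => by split_ifs <;> simp
  simp only [this, Finset.sum_ite_eq, Finset.mem_univ, if_true]

/-- Indicator sums pick out a value, `e = a` form (plumbing). [this work] -/
theorem sum_ite_mul_eq' (κ : Pt k → ℝ) (a : Pt k) : ∑ e : Pt k, (if e = a then (1 : ℝ) else 0) * κ e = κ a := by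
  have : ∀ e : Pt k, (if e = a then (1 : ℝ) else 0) * κ e = if e = a then κ e else 0 := fun e => by split_ifs <;> simp
  simp only [this, Finset.sum_ite_eq', Finset.mem_univ, if_true]

/-- Constants factor out of double sums (plumbing). [this work] -/
theorem sum₂_const_mul (c : ℝ) (g : Pt k → Pt k → ℝ) : ∑ e : Pt k, ∑ e' : Pt k, c * g e e' = c * ∑ e : Pt k, ∑ e' : Pt k, g e e' := by
  rw [mul_sum]; exact sum_congr rfl fun e _ => by rw [mul_sum]

/-- Double indicator sums pick out a value (plumbing). [this work] -/
theorem sum_ite₂_mul_eq (g : Pt k → Pt k → ℝ) (a b : Pt k) :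
    ∑ e : Pt k, ∑ e' : Pt k, (if a = e ∧ b = e' then (1 : ℝ) else 0) * g e e' = g a b := by
  have : ∀ e e' : Pt k, (if a = e ∧ b = e' then (1 : ℝ) else 0) * g e e' = if a = e then (if b = e' then g e e' else 0) else 0 := by
    intro e e'; split_ifs with h1 h2 h3 <;> simp_all
  simp only [this]
  simp only [Finset.sum_ite_eq, Finset.mem_univ, if_true, Finset.sum_ite_irrel, Finset.sum_const_zero]

/-- ★ The `θ`-free (N1) against `ψ = 1` is the linear form `Σ_e cK(e)·κ(e)`. [this work] -/
theorem N1form_zero_eq (π : Fin k → ℕ) (f κ : Pt k → ℝ) :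
    N1form k π f (fun _ _ _ => 0) κ 1 = ∑ e : Pt k, cKcoef π f e * κ e := by
  symm
  calc ∑ e : Pt k, cKcoef π f e * κ e
      = ∑ e : Pt k, ∑ σ : Pt k × Pt k × Pt k, arrInd π σ.1 σ.2.1 σ.2.2 *
          (2 * f σ.1 * ((if σ.1 = e then 1 else 0) * κ e) - f σ.1 * ((if σ.2.1 = e then 1 else 0) * κ e)) := by
        refine sum_congr rfl fun e _ => ?_
        rw [cKcoef, sum_mul]
        exact sum_congr rfl fun σ _ => by ring
    _ = ∑ σ : Pt k × Pt k × Pt k, ∑ e : Pt k, arrInd π σ.1 σ.2.1 σ.2.2 *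
          (2 * f σ.1 * ((if σ.1 = e then 1 else 0) * κ e) - f σ.1 * ((if σ.2.1 = e then 1 else 0) * κ e)) := sum_comm
    _ = N1form k π f (fun _ _ _ => 0) κ 1 := by
        unfold N1form
        refine sum_congr rfl fun σ _ => ?_
        rw [← mul_sum, sum_sub_distrib, ← mul_sum, ← mul_sum, sum_ite_mul_eq, sum_ite_mul_eq]
        simp only [Pi.one_apply]; ring

/-- ★ The `θ`-free (N2) is the bilinear form `Σ_{e,e′} B(e,e′)·φ(e)ψ(e′)`. [this work] -/
theorem N2form_zero_eq (π : Fin k → ℕ) (f φ ψ : Pt k → ℝ) :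
    N2form k π f (fun _ _ _ => 0) φ ψ = ∑ e : Pt k, ∑ e' : Pt k, Bcoef π f e e' * (φ e * ψ e') := by
  symm
  calc ∑ e : Pt k, ∑ e' : Pt k, Bcoef π f e e' * (φ e * ψ e')
      = ∑ e : Pt k, ∑ e' : Pt k, ∑ σ : Pt k × Pt k × Pt k, arrInd π σ.1 σ.2.1 σ.2.2 *
          (f σ.1 * ((if σ.2.1 = e ∧ σ.2.2 = e' then 1 else 0) * (φ e * ψ e'))
            - f σ.2.1 * ((if σ.1 = e ∧ σ.2.1 = e' then 1 else 0) * (φ e * ψ e'))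
            - f σ.2.1 * ((if σ.2.1 = e ∧ σ.1 = e' then 1 else 0) * (φ e * ψ e'))) := by
        refine sum_congr rfl fun e _ => sum_congr rfl fun e' _ => ?_
        rw [Bcoef, sum_mul]
        exact sum_congr rfl fun σ _ => by ring
    _ = ∑ e : Pt k, ∑ σ : Pt k × Pt k × Pt k, ∑ e' : Pt k, arrInd π σ.1 σ.2.1 σ.2.2 *
          (f σ.1 * ((if σ.2.1 = e ∧ σ.2.2 = e' then 1 else 0) * (φ e * ψ e'))
            - f σ.2.1 * ((if σ.1 = e ∧ σ.2.1 = e' then 1 else 0) * (φ e * ψ e'))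
            - f σ.2.1 * ((if σ.2.1 = e ∧ σ.1 = e' then 1 else 0) * (φ e * ψ e'))) := sum_congr rfl fun e _ => sum_comm
    _ = ∑ σ : Pt k × Pt k × Pt k, ∑ e : Pt k, ∑ e' : Pt k, arrInd π σ.1 σ.2.1 σ.2.2 *
          (f σ.1 * ((if σ.2.1 = e ∧ σ.2.2 = e' then 1 else 0) * (φ e * ψ e'))
            - f σ.2.1 * ((if σ.1 = e ∧ σ.2.1 = e' then 1 else 0) * (φ e * ψ e'))
            - f σ.2.1 * ((if σ.2.1 = e ∧ σ.1 = e' then 1 else 0) * (φ e * ψ e'))) := sum_comm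
    _ = N2form k π f (fun _ _ _ => 0) φ ψ := by
        unfold N2form
        refine sum_congr rfl fun σ _ => ?_
        have hA := sum_ite₂_mul_eq (fun a b => φ a * ψ b) σ.2.1 σ.2.2
        have hB := sum_ite₂_mul_eq (fun a b => φ a * ψ b) σ.1 σ.2.1
        have hC := sum_ite₂_mul_eq (fun a b => φ a * ψ b) σ.2.1 σ.1
        have h3 : ∀ e e' : Pt k, arrInd π σ.1 σ.2.1 σ.2.2 *
            (f σ.1 * ((if σ.2.1 = e ∧ σ.2.2 = e' then 1 else 0) * (φ e * ψ e'))
              - f σ.2.1 * ((if σ.1 = e ∧ σ.2.1 = e' then 1 else 0) * (φ e * ψ e'))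
              - f σ.2.1 * ((if σ.2.1 = e ∧ σ.1 = e' then 1 else 0) * (φ e * ψ e'))) =
            (arrInd π σ.1 σ.2.1 σ.2.2 * f σ.1) * ((if σ.2.1 = e ∧ σ.2.2 = e' then 1 else 0) * (φ e * ψ e'))
              - (arrInd π σ.1 σ.2.1 σ.2.2 * f σ.2.1) * ((if σ.1 = e ∧ σ.2.1 = e' then 1 else 0) * (φ e * ψ e'))
              - (arrInd π σ.1 σ.2.1 σ.2.2 * f σ.2.1) * ((if σ.2.1 = e ∧ σ.1 = e' then 1 else 0) * (φ e * ψ e')) := by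
          intro e e'; ring
        simp only [h3, sum_sub_distrib, sum₂_const_mul, hA, hB, hC]
        ring

/-! ### §3 Soundness of the two halves of a cell certificate -/

/-- Transfers act on `κ` as differences (plumbing). [this work] -/
theorem sum_transfers_eq (L : List (Pt k × Pt k × ℝ)) (κ : Pt k → ℝ) :
    ∑ e : Pt k, (L.map fun t => t.2.2 * ((if e = t.2.1 then (1:ℝ) else 0) - (if e = t.1 then 1 else 0))).sum * κ e =
      (L.map fun t => t.2.2 * (κ t.2.1 - κ t.1)).sum := by
  induction L with
  | nil => simp
  | cons t L ih =>
    simp only [List.map_cons, List.sum_cons, add_mul, sum_add_distrib, ih]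
    congr 1
    have h1 : ∀ e : Pt k, t.2.2 * ((if e = t.2.1 then (1:ℝ) else 0) - (if e = t.1 then 1 else 0)) * κ e =
        t.2.2 * ((if e = t.2.1 then (1:ℝ) else 0) * κ e) - t.2.2 * ((if e = t.1 then (1:ℝ) else 0) * κ e) := by
      intro e; ring
    simp only [h1, sum_sub_distrib, ← mul_sum, sum_ite_mul_eq']; ring

/-- Transfers along monotone steps with nonnegative weights are nonnegative on monotone `κ` (plumbing). [this work] -/
theorem transfers_nonneg (L : List (Pt k × Pt k × ℝ)) (hL : ∀ t ∈ L, t.1 ≤ t.2.1 ∧ 0 ≤ t.2.2) {κ : Pt k → ℝ} (hκm : Monotone κ) :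
    0 ≤ (L.map fun t => t.2.2 * (κ t.2.1 - κ t.1)).sum := by
  induction L with
  | nil => simp
  | cons t L ih =>
    simp only [List.map_cons, List.sum_cons]
    have ht := hL t (by simp)
    exact add_nonneg (mul_nonneg ht.2 (sub_nonneg.2 (hκm ht.1))) (ih fun t' h => hL t' (by simp [h]))

/-- A sum of rank-one terms evaluated on `(φ, ψ)` (plumbing). [this work] -/
theorem sum_rankOne_eq (L : List ((Pt k → ℝ) × (Pt k → ℝ) × ℝ)) (φ ψ : Pt k → ℝ) :
    ∑ e : Pt k, ∑ e' : Pt k, (L.map fun t => t.2.2 * (t.1 e * t.2.1 e')).sum * (φ e * ψ e') =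
      (L.map fun t => t.2.2 * ((∑ e, t.1 e * φ e) * ∑ e', t.2.1 e' * ψ e')).sum := by
  induction L with
  | nil => simp
  | cons t L ih =>
    simp only [List.map_cons, List.sum_cons, add_mul, sum_add_distrib, ih]
    congr 1
    rw [sum_mul_sum, mul_sum]
    refine sum_congr rfl fun e _ => ?_
    rw [mul_sum]
    exact sum_congr rfl fun e' _ => by ring

/-- Rank-one terms with admissible factors are nonnegative (plumbing). [this work] -/
theorem rankOne_nonneg (L : List ((Pt k → ℝ) × (Pt k → ℝ) × ℝ)) (hx : ∀ t ∈ L, 0 ≤ t.2.2) {φ ψ : Pt k → ℝ}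
    (hu : ∀ t ∈ L, 0 ≤ ∑ e, t.1 e * φ e) (hv : ∀ t ∈ L, 0 ≤ ∑ e, t.2.1 e * ψ e) :
    0 ≤ (L.map fun t => t.2.2 * ((∑ e, t.1 e * φ e) * ∑ e', t.2.1 e' * ψ e')).sum := by
  induction L with
  | nil => simp
  | cons t L ih =>
    simp only [List.map_cons, List.sum_cons]
    exact add_nonneg (mul_nonneg (hx t (by simp)) (mul_nonneg (hu t (by simp)) (hv t (by simp))))
      (ih (fun t' h => hx t' (by simp [h])) (fun t' h => hu t' (by simp [h])) (fun t' h => hv t' (by simp [h])))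

/-- ★ **(N1) from a K-certificate.**  If `cK − ρ = Σ_i λ_i (e_{q_i} − e_{p_i}) + σ` pointwise with `λ_i ≥ 0`, `p_i ≤ q_i` and `σ ≥ 0`, and every level
with `ρ ≠ 0` is a first copy, then (N1) with the weight `θ_ρ` holds for every nonnegative monotone `κ` against `1`. [this work] -/
theorem N1form_nonneg_of_Kcert (π : Fin k → ℕ) (f ρ σv : Pt k → ℝ) (L : List (Pt k × Pt k × ℝ))
    (hn : ∀ e, nArr1 π e ≠ 0 ∨ ρ e = 0) (hσ : ∀ e, 0 ≤ σv e)
    (hL : ∀ t ∈ L, t.1 ≤ t.2.1 ∧ 0 ≤ t.2.2)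
    (hK : ∀ e, cKcoef π f e - ρ e = (L.map fun t => t.2.2 * ((if e = t.2.1 then (1:ℝ) else 0) - (if e = t.1 then 1 else 0))).sum + σv e)
    {κ : Pt k → ℝ} (hκ0 : ∀ e, 0 ≤ κ e) (hκm : Monotone κ) :
    0 ≤ N1form k π f (thetaOf π ρ) κ 1 := by
  rw [N1form_split, N1form_zero_eq, thetaLin_thetaOf π ρ _ hn]
  simp only [Pi.mul_apply, Pi.one_apply, mul_one]
  rw [← sum_sub_distrib]
  have : ∀ e, cKcoef π f e * κ e - ρ e * κ e =
      (L.map fun t => t.2.2 * ((if e = t.2.1 then (1:ℝ) else 0) - (if e = t.1 then 1 else 0))).sum * κ e + σv e * κ e := by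
    intro e; rw [← sub_mul, hK, add_mul]
  simp only [this, sum_add_distrib, sum_transfers_eq]
  exact add_nonneg (transfers_nonneg L hL hκm) (sum_nonneg fun e _ => mul_nonneg (hσ e) (hκ0 e))

/-- ★ **(N2) on a cell from a GH-certificate.**  If `diag(ρ) + B = Σ_i x_i · u_i ⊗ v_i` entrywise with `x_i ≥ 0`, then (N2) with the weight `θ_ρ` holds at
every pair `(φ, ψ)` with `u_i·φ ≥ 0` and `v_i·ψ ≥ 0` for all `i` (Hall generators: all nonnegative monotone pairs; score differences: the cell). [this work] -/
theorem N2form_nonneg_of_GHcert (π : Fin k → ℕ) (f ρ : Pt k → ℝ) (L : List ((Pt k → ℝ) × (Pt k → ℝ) × ℝ))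
    (hn : ∀ e, nArr1 π e ≠ 0 ∨ ρ e = 0) (hx : ∀ t ∈ L, 0 ≤ t.2.2)
    (hGH : ∀ e e', (if e = e' then ρ e else 0) + Bcoef π f e e' = (L.map fun t => t.2.2 * (t.1 e * t.2.1 e')).sum)
    {φ ψ : Pt k → ℝ} (hu : ∀ t ∈ L, 0 ≤ ∑ e, t.1 e * φ e) (hv : ∀ t ∈ L, 0 ≤ ∑ e, t.2.1 e * ψ e) :
    0 ≤ N2form k π f (thetaOf π ρ) φ ψ := by
  rw [N2form_split, N2form_zero_eq, thetaLin_thetaOf π ρ _ hn]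
  simp only [Pi.mul_apply]
  have hdiag : ∑ e : Pt k, ρ e * (φ e * ψ e) = ∑ e : Pt k, ∑ e' : Pt k, (if e = e' then ρ e else 0) * (φ e * ψ e') := by
    refine sum_congr rfl fun e _ => ?_
    rw [Finset.sum_eq_single e]
    · simp
    · intro e' _ he; simp [Ne.symm he]
    · intro h; exact absurd (mem_univ _) h
  have key : (∑ e : Pt k, ∑ e' : Pt k, Bcoef π f e e' * (φ e * ψ e')) + ∑ e : Pt k, ρ e * (φ e * ψ e) =
      ∑ e : Pt k, ∑ e' : Pt k, (L.map fun t => t.2.2 * (t.1 e * t.2.1 e')).sum * (φ e * ψ e') := by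
    rw [hdiag, ← sum_add_distrib]
    refine sum_congr rfl fun e _ => ?_
    rw [← sum_add_distrib]
    refine sum_congr rfl fun e' _ => ?_
    rw [← hGH]; ring
  rw [key, sum_rankOne_eq]
  exact rankOne_nonneg L hx hu hv

end

end Summit.CriticalPhenomena.PercolationContinuityZ3.Theorems.SahiThreeCopy
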